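import Summits.Ventures.Crystal3D.Theorems.StickyWulffConstantNoReconstructionGainPredSlotBudgetRaisedThreeBudget
import Summits.Ventures.Crystal3D.Theorems.StickyWulffConstantNoReconstructionGainPredSlotBudgetRaisedThreeSpecial
import HarnessLib

/-!
# Raised up bond, three contacts: the count in cubic coordinates (all cases)

HONEST FRAMING. Part of the venture `Summits/Ventures/Crystal3D` (cell `crystal3d-full`), helper
`--supports` the crux `NoReconstructionGain` (stmt-Ventures-19144, route
`route-Ventures-StickyWulffConstant`), line `adhesion` (wulff-p1 g15).  The whole case analysis of
B1b₃ (`predSlotBudget_of_upBond_raised_three`, memo RAISED-g14.md §4) in mirror-normalised cubic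
coordinates (`√(2/3) ≤ −a+b+c`, `b ≤ a`, `0 ≤ a+b`), with the six pred-slot credits, the landed credit
of `−W₃`, the blocking of `±W₃` and the three level-hex indicators as abstract propositions fed from /
read back into coordinates, and the two landed cap budgets (`…RaisedLanded`, `…RaisedThreeLevel`) as
hypotheses: `coreR_three_coords`.  Strictly raised (`b < a`): integrality unless `−W₃` is credited and
`W₃` unblocked, then `raisedBudget_three` or four submerged slots; level (`a = b`): integrality unless the
cube-face normal (`cubicAxis_three_steep`) or the twin point (`twin_all_three`).

WHAT THIS IS NOT: the frame wrapper; rung F-C1 not moved.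
-/

namespace Summit.Ventures.Crystal3D.Theorems

/-- Reordering of a blocking disjunction (contact 2 first). -/
theorem or_perm213 {p₁ p₂ p₃ q : Prop} (h : p₂ ∨ p₁ ∨ p₃ ∨ q) : p₁ ∨ p₂ ∨ p₃ ∨ q :=
  h.elim (fun h2 => Or.inr (Or.inl h2)) (fun h => h.elim (fun h1 => Or.inl h1) (fun h => Or.inr (Or.inr h)))

/-- Reordering of a blocking disjunction (contact 3 first). -/
theorem or_perm312 {p₁ p₂ p₃ q : Prop} (h : p₃ ∨ p₁ ∨ p₂ ∨ q) : p₁ ∨ p₂ ∨ p₃ ∨ q :=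
  h.elim (fun h3 => Or.inr (Or.inr (Or.inl h3)))
    (fun h => h.elim (fun h1 => Or.inl h1) (fun h => h.elim (fun h2 => Or.inr (Or.inl h2)) (fun hq => Or.inr (Or.inr (Or.inr hq)))))

/-- Reordering of a three-way disjunction (second first). -/
theorem or_perm213' {p₁ p₂ p₃ : Prop} (h : p₂ ∨ p₁ ∨ p₃) : p₁ ∨ p₂ ∨ p₃ :=
  h.elim (fun h2 => Or.inr (Or.inl h2)) (fun h => h.elim Or.inl (fun h3 => Or.inr (Or.inr h3)))

/-- Reordering of a three-way disjunction (third first). -/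
theorem or_perm312' {p₁ p₂ p₃ : Prop} (h : p₃ ∨ p₁ ∨ p₂) : p₁ ∨ p₂ ∨ p₃ :=
  h.elim (fun h3 => Or.inr (Or.inr h3)) (fun h => h.elim Or.inl (fun h2 => Or.inr (Or.inl h2)))

/-- **Three contacts, all cases, in coordinates.**  See the module docstring. -/
theorem coreR_three_coords {a b c T x₁ y₁ z₁ x₂ y₂ z₂ x₃ y₃ z₃ : ℝ} (hn : a ^ 2 + b ^ 2 + c ^ 2 = 2)
    (hs : Real.sqrt (2 / 3) ≤ -a + b + c) (hba : b ≤ a) (hab : 0 ≤ a + b)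
    (hu₁ : x₁ ^ 2 + y₁ ^ 2 + z₁ ^ 2 = 2) (hd₁ : T ≤ a * x₁ + b * y₁ + c * z₁)
    (hu₂ : x₂ ^ 2 + y₂ ^ 2 + z₂ ^ 2 = 2) (hd₂ : T ≤ a * x₂ + b * y₂ + c * z₂)
    (hu₃ : x₃ ^ 2 + y₃ ^ 2 + z₃ ^ 2 = 2) (hd₃ : T ≤ a * x₃ + b * y₃ + c * z₃)
    (h12 : x₁ * x₂ + y₁ * y₂ + z₁ * z₂ ≤ 1) (h13 : x₁ * x₃ + y₁ * y₃ + z₁ * z₃ ≤ 1)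
    (h23 : x₂ * x₃ + y₂ * y₃ + z₂ * z₃ ≤ 1)
    (PB1 PB2 PB3 PW1 PW2 PW3 PD PWb PDb L1 L2 L3 : Prop) [Decidable PB1] [Decidable PB2] [Decidable PB3]
    [Decidable PW1] [Decidable PW2] [Decidable PW3] [Decidable PD] [Decidable PWb] [Decidable PDb]
    [Decidable L1] [Decidable L2] [Decidable L3]
    (hB1 : ((1 < x₁ + y₁ ∨ 1 < x₂ + y₂ ∨ 1 < x₃ + y₃) ∨ (0 < a + b ∧ T ≤ a + b)) → PB1)
    (hB2 : 0 < a + c → (1 < x₁ + z₁ ∨ 1 < x₂ + z₂ ∨ 1 < x₃ + z₃ ∨ T ≤ a + c) → PB2)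
    (hB3 : b < c → (1 < z₁ - y₁ ∨ 1 < z₂ - y₂ ∨ 1 < z₃ - y₃ ∨ T ≤ c - b) → PB3)
    (hW1 : (1 < y₁ + z₁ ∨ 1 < y₂ + z₂ ∨ 1 < y₃ + z₃ ∨ T ≤ b + c) → PW1)
    (hW2 : (1 < z₁ - x₁ ∨ 1 < z₂ - x₂ ∨ 1 < z₃ - x₃ ∨ T ≤ c - a) → PW2)
    (hW3 : PW3 ↔ (1 < y₁ - x₁ ∨ 1 < y₂ - x₂ ∨ 1 < y₃ - x₃))
    (hD : PD → ((1 < x₁ - y₁ ∨ 1 < x₂ - y₂ ∨ 1 < x₃ - y₃) ∨ T ≤ a - b))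
    (hWb : PWb → PW3)
    (hL1 : L1 → a + b = 0) (hL2 : L2 → a + c = 0) (hL3 : L3 → c = b)
    (hL : b < a → (3 : ℝ) ≤ (if PB1 then (1 : ℝ) else 0) + 1 / 2 * (if L1 then (1 : ℝ) else 0) +
      ((if PB2 then (1 : ℝ) else 0) + 1 / 2 * (if L2 then (1 : ℝ) else 0)) +
      ((if PB3 then (1 : ℝ) else 0) + 1 / 2 * (if L3 then (1 : ℝ) else 0)) +
      (if PW1 then (1 : ℝ) else 0) + (if PW2 then (1 : ℝ) else 0) + (if PD then (1 : ℝ) else 0))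
    (hLv : a = b → (3 : ℝ) ≤ (if PB1 then (1 : ℝ) else 0) + 1 / 2 * (if L1 then (1 : ℝ) else 0) +
      ((if PB2 then (1 : ℝ) else 0) + 1 / 2 * (if L2 then (1 : ℝ) else 0)) +
      ((if PB3 then (1 : ℝ) else 0) + 1 / 2 * (if L3 then (1 : ℝ) else 0)) +
      (if PW1 then (1 : ℝ) else 0) + (if PW2 then (1 : ℝ) else 0) +
      (1 / 2 * (if PWb then (1 : ℝ) else 0) + 1 / 2 * (if PDb then (1 : ℝ) else 0))) :
    (3 : ℝ) ≤ (if PB1 then (1 : ℝ) else 0) + (if PB2 then (1 : ℝ) else 0) + (if PB3 then (1 : ℝ) else 0) +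
      (if PW1 then (1 : ℝ) else 0) + (if PW2 then (1 : ℝ) else 0) + (if PW3 then (1 : ℝ) else 0) := by
  obtain ⟨ha, hab', h3a, has, hs0c, hac⟩ := regionR_bounds hn hs hba hab
  have hpos : 0 < Real.sqrt (2 / 3) := Real.sqrt_pos.2 (by norm_num)
  have hac0 : 0 < a + c := by linarith
  -- nonnegativity / boundedness of indicators
  have n1 : (0 : ℝ) ≤ (if PB1 then (1 : ℝ) else 0) := by split_ifs <;> norm_num
  have n2 : (0 : ℝ) ≤ (if PB2 then (1 : ℝ) else 0) := by split_ifs <;> norm_num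
  have n3 : (0 : ℝ) ≤ (if PB3 then (1 : ℝ) else 0) := by split_ifs <;> norm_num
  have n4 : (0 : ℝ) ≤ (if PW1 then (1 : ℝ) else 0) := by split_ifs <;> norm_num
  have n5 : (0 : ℝ) ≤ (if PW2 then (1 : ℝ) else 0) := by split_ifs <;> norm_num
  have n6 : (0 : ℝ) ≤ (if PW3 then (1 : ℝ) else 0) := by split_ifs <;> norm_num
  have uD : (if PD then (1 : ℝ) else 0) ≤ 1 := by split_ifs <;> norm_num
  have uDb : (if PDb then (1 : ℝ) else 0) ≤ 1 := by split_ifs <;> norm_num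
  have uWb : (if PWb then (1 : ℝ) else 0) ≤ (if PW3 then (1 : ℝ) else 0) := by
    by_cases h : PWb
    · rw [if_pos h, if_pos (hWb h)]
    · rw [if_neg h]; exact n6
  have uL1 : (if L1 then (1 : ℝ) else 0) ≤ 1 := by split_ifs <;> norm_num
  have eL2 : (if L2 then (1 : ℝ) else 0) = 0 := if_neg (fun h => by linarith only [hL2 h, hac0])
  have integral : (3 : ℝ) ≤ (if PB1 then (1 : ℝ) else 0) + (if PB2 then (1 : ℝ) else 0) +
      (if PB3 then (1 : ℝ) else 0) + (if PW1 then (1 : ℝ) else 0) + (if PW2 then (1 : ℝ) else 0) +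
      (if PW3 then (1 : ℝ) else 0) + 1 / 2 →
      (3 : ℝ) ≤ (if PB1 then (1 : ℝ) else 0) + (if PB2 then (1 : ℝ) else 0) +
      (if PB3 then (1 : ℝ) else 0) + (if PW1 then (1 : ℝ) else 0) + (if PW2 then (1 : ℝ) else 0) +
      (if PW3 then (1 : ℝ) else 0) := fun h =>
    natCast_le_of_le_indicators_add_half 3 _ _ _ _ _ _ (by exact_mod_cast h)
  -- four submerged steep slots
  have four : b < c → T ≤ a + c → T ≤ c - b → T ≤ b + c → T ≤ c - a → (3 : ℝ) ≤ (if PB1 then (1 : ℝ) else 0) +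
      (if PB2 then (1 : ℝ) else 0) + (if PB3 then (1 : ℝ) else 0) + (if PW1 then (1 : ℝ) else 0) +
      (if PW2 then (1 : ℝ) else 0) + (if PW3 then (1 : ℝ) else 0) := by
    intro hbc i2 i3 i4 i5
    have e2 : (if PB2 then (1 : ℝ) else 0) = 1 := if_pos (hB2 hac0 (Or.inr (Or.inr (Or.inr i2))))
    have e3 : (if PB3 then (1 : ℝ) else 0) = 1 := if_pos (hB3 hbc (Or.inr (Or.inr (Or.inr i3))))
    have e4 : (if PW1 then (1 : ℝ) else 0) = 1 := if_pos (hW1 (Or.inr (Or.inr (Or.inr i4))))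
    have e5 : (if PW2 then (1 : ℝ) else 0) = 1 := if_pos (hW2 (Or.inr (Or.inr (Or.inr i5))))
    linarith only [e2, e3, e4, e5, n1, n6]
  rcases lt_or_eq_of_le hba with hlt | heq
  · -- STRICTLY RAISED `W₃`
    have hbc : b < c := lt_of_lt_of_le hlt hac
    have L := hL hlt
    have eL3 : (if L3 then (1 : ℝ) else 0) = 0 := if_neg (fun h => by linarith only [hL3 h, hbc])
    by_cases hw : PW3
    · have e6 : (if PW3 then (1 : ℝ) else 0) = 1 := if_pos hw
      exact integral (by linarith only [L, uL1, eL2, eL3, uD, e6, n1, n2, n3, n4, n5])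
    by_cases hd : PD
    · -- sub-case (iii): `−W₃` credited, `W₃` unblocked
      have nw : ¬ (1 < y₁ - x₁ ∨ 1 < y₂ - x₂ ∨ 1 < y₃ - x₃) := fun h => hw (hW3.2 h)
      push Not at nw
      obtain ⟨w₁, w₂, w₃⟩ := nw
      rcases le_or_gt T (a - b) with hTab | hTgt
      · exact four hbc (by linarith only [hTab, hab', hac]) (by linarith only [hTab, hac])
          (by linarith only [hTab, hs, hab', has]) (by linarith only [hTab, hs, has])
      have hx := (hD hd).resolve_right (not_le.2 hTgt)
      rcases hx with hx | hx | hx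
      · exact raisedBudget_three hn hs hlt hab hu₁ hd₁ hu₂ hd₂ hu₃ hd₃ h12 h13 h23 hTgt hx w₁ w₂ w₃
          PB1 PB2 PB3 PW1 PW2 PW3 hB1 hB2 hB3 hW1 hW2
      · exact raisedBudget_three hn hs hlt hab hu₂ hd₂ hu₁ hd₁ hu₃ hd₃ (by linarith only [h12]) h23 h13 hTgt hx
          w₂ w₁ w₃ PB1 PB2 PB3 PW1 PW2 PW3 (fun h => hB1 (h.imp or_perm213' id)) (fun h0 h => hB2 h0 (or_perm213 h))
          (fun h0 h => hB3 h0 (or_perm213 h)) (fun h => hW1 (or_perm213 h)) (fun h => hW2 (or_perm213 h))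
      · exact raisedBudget_three hn hs hlt hab hu₃ hd₃ hu₁ hd₁ hu₂ hd₂ (by linarith only [h13]) (by linarith only [h23])
          h12 hTgt hx w₃ w₁ w₂ PB1 PB2 PB3 PW1 PW2 PW3 (fun h => hB1 (h.imp or_perm312' id))
          (fun h0 h => hB2 h0 (or_perm312 h)) (fun h0 h => hB3 h0 (or_perm312 h)) (fun h => hW1 (or_perm312 h))
          (fun h => hW2 (or_perm312 h))
    · have eD : (if PD then (1 : ℝ) else 0) = 0 := if_neg hd
      exact integral (by linarith only [L, uL1, eL2, eL3, eD, n1, n2, n3, n4, n5, n6])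
  · -- LEVEL `W₃` (`a = b`)
    by_cases ha0 : a = 0
    · -- the cube-face normal: `a = b = 0`
      have hb0 : b = 0 := by rw [heq, ha0]
      have hbc : b < c := by rw [hb0]; linarith only [hs0c, hpos]
      rcases le_or_gt T c with hTc | hTc
      · exact four hbc (by linarith only [hTc, ha0]) (by linarith only [hTc, hb0]) (by linarith only [hTc, hb0])
          (by linarith only [hTc, ha0])
      have hz : ∀ {X Y Z : ℝ}, T ≤ a * X + b * Y + c * Z → 1 < Z := by
        intro X Y Z hd
        rw [ha0, hb0] at hd
        by_contra h
        push Not at h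
        nlinarith only [hd, hTc, h, hs0c, hpos, mul_le_mul_of_nonneg_left h (by linarith only [hs0c, hpos] : (0:ℝ) ≤ c)]
      have cub := cubicAxis_three_steep (hz hd₁) (hz hd₂) h12
      have i1 : (if (1 < x₁ + z₁ ∨ 1 < x₂ + z₂) then (1 : ℝ) else 0) ≤ (if PB2 then (1 : ℝ) else 0) := by
        by_cases h : 1 < x₁ + z₁ ∨ 1 < x₂ + z₂
        · rw [if_pos h, if_pos (hB2 hac0 (h.elim Or.inl (fun e => Or.inr (Or.inl e))))]
        · rw [if_neg h]; exact n2
      have i2 : (if (1 < z₁ - x₁ ∨ 1 < z₂ - x₂) then (1 : ℝ) else 0) ≤ (if PW2 then (1 : ℝ) else 0) := by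
        by_cases h : 1 < z₁ - x₁ ∨ 1 < z₂ - x₂
        · rw [if_pos h, if_pos (hW2 (h.elim Or.inl (fun e => Or.inr (Or.inl e))))]
        · rw [if_neg h]; exact n5
      have i3 : (if (1 < y₁ + z₁ ∨ 1 < y₂ + z₂) then (1 : ℝ) else 0) ≤ (if PW1 then (1 : ℝ) else 0) := by
        by_cases h : 1 < y₁ + z₁ ∨ 1 < y₂ + z₂
        · rw [if_pos h, if_pos (hW1 (h.elim Or.inl (fun e => Or.inr (Or.inl e))))]
        · rw [if_neg h]; exact n4
      have i4 : (if (1 < z₁ - y₁ ∨ 1 < z₂ - y₂) then (1 : ℝ) else 0) ≤ (if PB3 then (1 : ℝ) else 0) := by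
        by_cases h : 1 < z₁ - y₁ ∨ 1 < z₂ - y₂
        · rw [if_pos h, if_pos (hB3 hbc (h.elim Or.inl (fun e => Or.inr (Or.inl e))))]
        · rw [if_neg h]; exact n3
      linarith only [cub, i1, i2, i3, i4, n1, n6]
    by_cases hcb : c = b
    · -- the twin point: `a = b = c`
      rcases le_or_gt T (2 * c) with hTc | hTc
      · have ha' : 0 < a := lt_of_le_of_ne ha (Ne.symm ha0)
        have e1 : (if PB1 then (1 : ℝ) else 0) = 1 :=
          if_pos (hB1 (Or.inr ⟨by linarith only [ha', heq], by linarith only [hTc, heq, hcb]⟩))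
        have e2 : (if PB2 then (1 : ℝ) else 0) = 1 :=
          if_pos (hB2 hac0 (Or.inr (Or.inr (Or.inr (by linarith only [hTc, heq, hcb])))))
        have e4 : (if PW1 then (1 : ℝ) else 0) = 1 :=
          if_pos (hW1 (Or.inr (Or.inr (Or.inr (by linarith only [hTc, heq, hcb])))))
        linarith only [e1, e2, e4, n3, n5, n6]
      have hc0 : 0 < c := by linarith only [hs0c, hpos]
      have hsum : ∀ {X Y Z : ℝ}, T ≤ a * X + b * Y + c * Z → 2 < X + Y + Z := by
        intro X Y Z hd
        have e : a * X + b * Y + c * Z = c * (X + Y + Z) := by rw [← heq, ← hcb]; ring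
        rw [e] at hd
        by_contra h
        push Not at h
        nlinarith only [hd, hTc, h, hc0, mul_le_mul_of_nonneg_left h hc0.le]
      obtain ⟨t1, t2, t3⟩ := twin_all_three hu₁ hu₂ hu₃ (hsum hd₁) (hsum hd₂) (hsum hd₃) h12 h13 h23
      have e1 : (if PB1 then (1 : ℝ) else 0) = 1 := if_pos (hB1 (Or.inl t1))
      have e2 : (if PB2 then (1 : ℝ) else 0) = 1 := if_pos (hB2 hac0 (t2.imp id (fun h => h.imp id Or.inl)))
      have e4 : (if PW1 then (1 : ℝ) else 0) = 1 := if_pos (hW1 (t3.imp id (fun h => h.imp id Or.inl)))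
      linarith only [e1, e2, e4, n3, n5, n6]
    -- generic level frame: no level hex pair
    have Lv := hLv heq.symm
    have eL1 : (if L1 then (1 : ℝ) else 0) = 0 := if_neg (fun h => ha0 (by linarith only [hL1 h, heq]))
    have eL3 : (if L3 then (1 : ℝ) else 0) = 0 := if_neg (fun h => hcb (hL3 h))
    exact integral (by linarith only [Lv, eL1, eL2, eL3, uWb, uDb, n1, n2, n3, n4, n5, n6])

end Summit.Ventures.Crystal3D.Theorems
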